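import Mathlib
import HarnessLib
import Summits.HubbardSuperconductivity.HubbardSuperconductivity.Theorems.KLProgrammeKLRegimeEngineV8E5CarrierLines

/-!
# Route `KLProgramme` — ENGINE child gen 8 (stmt-HubbardSuperconductivity-20437 `KLRegimeEngineV17F2`), SKELETON v2 class #3, (RA-U) SUPPLIER:
# the TEXTS of the supplier's row datum (b) `E5SliceRowsAt` with its size law `E5SliceRowsLawAt`, and of the supplier's output `E5CarrierLawAt` /
# `E5CarrierLawTrivAt` (= the (RA-U) / (RA-U)₀ rows of `exists_e5Pkg2_of_rows` by name)
# (cell gate-hubbard-kl, seat p5 g11; pen (R71e) «(RA-U) supplier owner = p5», (R71g) «(b) … text from p5's Props file»; memo RA-U-SUPPLY §3 (b), §5, §6)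

WHY.  The (RA-U) supplier (memo RA-U-SUPPLY §5) applies the graded prescribed door `carrierStep_ordersGe2_lev_le` (…E5CarrierBlockStep) to the DRESSED
PARTIAL SLICE `C_Λ = klE5DressedSlice … κ Λ = normalCovariance (s_Λ/(1 + s_Λκ))` (`s_Λ = klE5SliceSym`, `κ = klE5Kappa`, `Λ ∈ [Λ_n, Λ_{n−1}]`), whose
`hrow`/`hcol` inputs on the point-augmented fat family are TRANSFERRED from the PLAIN fat family `bgmFatMultiplier … m` by the last clause of
`gram_softShaped_pointAugmentFat_klEng` (…E5CarrierLines §6).  The plain-fat row/column sums themselves are an (L1)-type datum — position-space `ℓ¹`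
decay of the sectorised dressed line, which needs the dressing's `k`-smoothness — owned by the (L1) owners (p1 lineage / k3c1; pen (R71e)/(R71g)).
This module fixes their TEXT and SIZE LAW so both sides compose by name:

* §1 **`E5SliceRowsAt L M β μ K n₀ κ Λ m α`** — rows AND columns of `S(F̃^K_m)ᵀ · klE5DressedSlice L M β μ K n₀ κ Λ · S(F̃^K_m)` are `≤ α`,
  `F̃^K_m = bgmFatMultiplier L M klE0 β (nambuXiCT L μ K) m` (generic frame `K`, scale index `n₀`, dressing `κ`); `e5SliceRowsAt_iff_normalCovariance`
  (the `normalCovariance (fun ks ↦ s/(1+sκ))` spelling the transfer clause reads), `.mono`, `.rows`/`.cols`;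
* §2 **`E5SliceRowsLawAt L M β U μ n m Cb`** — the (R1′) instance at the frame `K_n = klFlowFrameU … n`, `n₀ = n−1`, `κ = klE5Kappa … (n−1)`: for every
  `Λ ∈ [Λ_n, Λ_{n−1}]` some `α ≥ 0` with `E5SliceRowsAt … Λ m α` and the SIZE LAW **`α ≤ Cb·(imagTimeWeight β M)⁻¹·4ⁿ/e₀`** (`= Cb·ε⁻¹/Λ_n`,
  `e5SliceRowsLaw_bound_eq`); the supplier reads it at `m = n−4` (door input family of the increment) [and `m = n−3` if the second reading of the
  increment is born at `J₁ = n−2`]; `.mono` in `Cb`.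
  SIZE-LAW RATIONALE (numbers, not a proof): a scale-`n` line has momentum-space sup `≤ 2βL²/Λ_n` (`norm_klE5DressedSliceSym_le_div_radius`, `A_p = 2`)
  on a shell of radial width `≍ Λ_n`; its position-space `ℓ¹` norm through ONE fat sector of level `m ≤ n−2` is `≲ (#time-mesh points per unit time = ε⁻¹)·
  C/Λ_n` with `C` depending on `n − m ≤ 4`, the cutoff/sector profile constants and the dressing's smoothness — the same shape as the bare slice's closed form
  `rowSum_sliceCT_bgmFat_closed` (`≤ 288·√(32·C_W·C_N)·(M/β)/Λ`, …AlphaFatClosedRows) and as the (L1) law of `exists_e5Pkg2_of_rows`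
  (`α ≤ (Λ_{n−1} − Λ_n)·Cα·ε⁻¹·16ⁿ/e₀² = 3·Cα·ε⁻¹·4ⁿ/e₀` for the `Λ`-derivative line); the row count over neighbouring sectors is absorbed in `Cb`.
* §3 **`E5CarrierLawAt L M β U μ n Λ Qm x y g C₀ Θ`** — the (RA-U) row of `h3` in `exists_e5Pkg2_of_rows` BY NAME (even degrees `m ≥ 4`, every prescription
  `Ωe` at the point-augmented anisotropic family of level `n−2`: `‖W_Λ‖ ≤ C₀·Θ^{m/2}·g^{m/2−1}·2^{(3m/2−5)(n−2)}·(2^{−(n−2)})^{levelGainExp (levelCount Ωe)}`,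
  coupling currency `g` GENERIC — `g := P.Klam·U` under reading (A), pen (R71d); `B·P.Klam·U` if (Q-E1-λ) says so), and **`E5CarrierLawTrivAt … n Λ g C₀ Θ`**
  the flat (RA-U)₀ row of `h12r`; `e5CarrierLaw_h3_of` / `e5CarrierLawTriv_h12r_of` restate them as the literal conjunct texts (definitional unfoldings).

Definitions with bodies + `Iff.rfl`/order bookkeeping; no named facts; nothing about the model's sizes is asserted; nothing asserts superconductivity.
-/

noncomputable section

namespace Summit.HubbardSuperconductivity.HubbardSuperconductivity.Theorems.KLRegimeSplit

set_option linter.dupNamespace false -- summit = problem name (single-conjunct summit), D-0017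

open Real Finset Literature.MathematicalPhysics.QuantumLattice Literature.Probability.LatticeModels GrassmannAlgebra Matrix
open Literature.MathematicalPhysics.QuantumLattice.FermiRG
open Summit.HubbardSuperconductivity.HubbardSuperconductivity.Theorems.KLProgrammeLegKernels
open Summit.HubbardSuperconductivity.HubbardSuperconductivity.Theorems.KLRegimeWick
open Summit.HubbardSuperconductivity.HubbardSuperconductivity.Theorems.EngineV8
open Summit.HubbardSuperconductivity.HubbardSuperconductivity.Theorems.TwoPointAssembly
open Summit.HubbardSuperconductivity.HubbardSuperconductivity.Theorems.TorusFourierL2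
open Summit.HubbardSuperconductivity.HubbardSuperconductivity.Theorems.DispersionFlow

/-! ## §1 The row datum (b): plain-fat row/column sums of the sectorised dressed partial slice -/

section Datum

variable (L M : ℕ) [NeZero L]

/-- **`E5SliceRowsAt L M β μ K n₀ κ Λ m α`** — the (RA-U) supplier's row datum (b): on the PLAIN fat family `F̃^K_m = bgmFatMultiplier … m` of level `m`,
the row sums AND the column sums of the sectorised dressed partial slice `S(F̃^K_m)ᵀ · C_Λ · S(F̃^K_m)`, `C_Λ = klE5DressedSlice L M β μ K n₀ κ Λ =
normalCovariance (s_Λ/(1 + s_Λκ))`, are `≤ α` (the `hrow`/`hcol` shape of the one-step doors, before transfer to the point-augmented family). -/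
def E5SliceRowsAt (β μ : ℝ) (K : TrigPolyC4v) (n₀ : ℕ) (κ : FreqMomentum L M × Fin 2 → ℂ) (Λ : ℝ) (m : ℕ) (α : ℝ) : Prop :=
  (∀ X, ∑ Y, ‖((sectorSubMatrix L M β (bgmFatMultiplier L M klE0 β (nambuXiCT L μ K) m)).transpose * klE5DressedSlice L M β μ K n₀ κ Λ *
      sectorSubMatrix L M β (bgmFatMultiplier L M klE0 β (nambuXiCT L μ K) m)) X Y‖ ≤ α) ∧
  (∀ Y, ∑ X, ‖((sectorSubMatrix L M β (bgmFatMultiplier L M klE0 β (nambuXiCT L μ K) m)).transpose * klE5DressedSlice L M β μ K n₀ κ Λ *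
      sectorSubMatrix L M β (bgmFatMultiplier L M klE0 β (nambuXiCT L μ K) m)) X Y‖ ≤ α)

variable {L M}

/-- `E5SliceRowsAt` in the `normalCovariance (fun ks ↦ s_Λ ks / (1 + s_Λ ks · κ ks))` spelling — the form the transfer clause of
`gram_softShaped_pointAugmentFat_klEng` and the carrier doors read (definitional). -/
theorem e5SliceRowsAt_iff_normalCovariance (β μ : ℝ) (K : TrigPolyC4v) (n₀ : ℕ) (κ : FreqMomentum L M × Fin 2 → ℂ) (Λ : ℝ) (m : ℕ) (α : ℝ) :
    E5SliceRowsAt L M β μ K n₀ κ Λ m α ↔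
      (∀ X, ∑ Y, ‖((sectorSubMatrix L M β (bgmFatMultiplier L M klE0 β (nambuXiCT L μ K) m)).transpose *
          normalCovariance L M (fun ks => klE5SliceSym L M β μ K n₀ Λ ks / (1 + klE5SliceSym L M β μ K n₀ Λ ks * κ ks)) *
          sectorSubMatrix L M β (bgmFatMultiplier L M klE0 β (nambuXiCT L μ K) m)) X Y‖ ≤ α) ∧
      (∀ Y, ∑ X, ‖((sectorSubMatrix L M β (bgmFatMultiplier L M klE0 β (nambuXiCT L μ K) m)).transpose *
          normalCovariance L M (fun ks => klE5SliceSym L M β μ K n₀ Λ ks / (1 + klE5SliceSym L M β μ K n₀ Λ ks * κ ks)) *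
          sectorSubMatrix L M β (bgmFatMultiplier L M klE0 β (nambuXiCT L μ K) m)) X Y‖ ≤ α) :=
  Iff.rfl

/-- The rows half of the datum. -/
theorem E5SliceRowsAt.rows {β μ : ℝ} {K : TrigPolyC4v} {n₀ : ℕ} {κ : FreqMomentum L M × Fin 2 → ℂ} {Λ : ℝ} {m : ℕ} {α : ℝ}
    (h : E5SliceRowsAt L M β μ K n₀ κ Λ m α) (X : SpaceTimeIdx L M × SectorLeg (sectorCount m)) :
    ∑ Y, ‖((sectorSubMatrix L M β (bgmFatMultiplier L M klE0 β (nambuXiCT L μ K) m)).transpose * klE5DressedSlice L M β μ K n₀ κ Λ *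
      sectorSubMatrix L M β (bgmFatMultiplier L M klE0 β (nambuXiCT L μ K) m)) X Y‖ ≤ α :=
  h.1 X

/-- The columns half of the datum. -/
theorem E5SliceRowsAt.cols {β μ : ℝ} {K : TrigPolyC4v} {n₀ : ℕ} {κ : FreqMomentum L M × Fin 2 → ℂ} {Λ : ℝ} {m : ℕ} {α : ℝ}
    (h : E5SliceRowsAt L M β μ K n₀ κ Λ m α) (Y : SpaceTimeIdx L M × SectorLeg (sectorCount m)) :
    ∑ X, ‖((sectorSubMatrix L M β (bgmFatMultiplier L M klE0 β (nambuXiCT L μ K) m)).transpose * klE5DressedSlice L M β μ K n₀ κ Λ *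
      sectorSubMatrix L M β (bgmFatMultiplier L M klE0 β (nambuXiCT L μ K) m)) X Y‖ ≤ α :=
  h.2 Y

/-- Monotonicity of the datum in the bound. -/
theorem E5SliceRowsAt.mono {β μ : ℝ} {K : TrigPolyC4v} {n₀ : ℕ} {κ : FreqMomentum L M × Fin 2 → ℂ} {Λ : ℝ} {m : ℕ} {α α' : ℝ}
    (h : E5SliceRowsAt L M β μ K n₀ κ Λ m α) (hαα' : α ≤ α') : E5SliceRowsAt L M β μ K n₀ κ Λ m α' :=
  ⟨fun X => (h.1 X).trans hαα', fun Y => (h.2 Y).trans hαα'⟩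

end Datum

/-! ## §2 The size law of the datum at the flow frame -/

section Law

variable (L M : ℕ) [NeZero L] [NeZero M]

/-- **`E5SliceRowsLawAt L M β U μ n m Cb`** — the (b) datum WITH ITS SIZE LAW at the step `n−1 → n` of the (R1′) organisation (frame `K_n = klFlowFrameU … n`,
scale index `n−1`, dressing `κ = klE5Kappa … (n−1)`), fat level `m`: for every cutoff `Λ ∈ [Λ_n, Λ_{n−1}]` there is `α ≥ 0` with
`E5SliceRowsAt … Λ m α` and `α ≤ Cb·(imagTimeWeight β M)⁻¹·4ⁿ/e₀` (`= Cb·ε⁻¹/Λ_n`: the `ℓ¹` size of a scale-`n` line per unit time mesh; `Cb` n-uniform,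
owned by the (L1) owners). -/
def E5SliceRowsLawAt (β U μ : ℝ) (n m : ℕ) (Cb : ℝ) : Prop :=
  ∀ Λ ∈ Set.Icc (klScale klE0 n) (klScale klE0 (n - 1)), ∃ α : ℝ, 0 ≤ α ∧
    E5SliceRowsAt L M β μ (klFlowFrameU L M β U μ n) (n - 1) (klE5Kappa L M β U μ (klFlowFrameU L M β U μ n) (n - 1)) Λ m α ∧
    α ≤ Cb * (imagTimeWeight β M)⁻¹ * (4 : ℝ) ^ n / klE0

variable {L M}

/-- The size law's bound is `Cb·ε⁻¹/Λ_n` (`Λ_n = klScale klE0 n = e₀·4^{−n}`). -/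
theorem e5SliceRowsLaw_bound_eq (β : ℝ) (M n : ℕ) (Cb : ℝ) :
    Cb * (imagTimeWeight β M)⁻¹ * (4 : ℝ) ^ n / klE0 = Cb * (imagTimeWeight β M)⁻¹ / klScale klE0 n := by
  unfold klScale
  have h4 : (4 : ℝ) ^ n ≠ 0 := pow_ne_zero _ (by norm_num)
  have he : (klE0 : ℝ) ≠ 0 := by norm_num [klE0]
  field_simp

/-- Monotonicity of the law in its constant (`0 ≤ β`). -/
theorem E5SliceRowsLawAt.mono {β U μ : ℝ} (hβ : 0 ≤ β) {n m : ℕ} {Cb Cb' : ℝ} (h : E5SliceRowsLawAt L M β U μ n m Cb) (hC : Cb ≤ Cb') :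
    E5SliceRowsLawAt L M β U μ n m Cb' := by
  intro Λ hΛ
  obtain ⟨α, hα, hrows, hle⟩ := h Λ hΛ
  refine ⟨α, hα, hrows, hle.trans ?_⟩
  have hε : 0 ≤ (imagTimeWeight β M)⁻¹ := inv_nonneg.2 (imagTimeWeight_nonneg hβ M)
  have he : (0 : ℝ) < klE0 := by norm_num [klE0]
  exact div_le_div_of_nonneg_right (mul_le_mul_of_nonneg_right (mul_le_mul_of_nonneg_right hC hε) (pow_nonneg (by norm_num) n)) he.le

/-- Reading the law at one cutoff in the `normalCovariance` spelling of the transfer clause / doors. -/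
theorem E5SliceRowsLawAt.exists_normalCovariance {β U μ : ℝ} {n m : ℕ} {Cb : ℝ} (h : E5SliceRowsLawAt L M β U μ n m Cb)
    {Λ : ℝ} (hΛ : Λ ∈ Set.Icc (klScale klE0 n) (klScale klE0 (n - 1))) :
    ∃ α : ℝ, 0 ≤ α ∧
      (∀ X, ∑ Y, ‖((sectorSubMatrix L M β (bgmFatMultiplier L M klE0 β (nambuXiCT L μ (klFlowFrameU L M β U μ n)) m)).transpose *
          normalCovariance L M (fun ks => klE5SliceSym L M β μ (klFlowFrameU L M β U μ n) (n - 1) Λ ks /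
            (1 + klE5SliceSym L M β μ (klFlowFrameU L M β U μ n) (n - 1) Λ ks * klE5Kappa L M β U μ (klFlowFrameU L M β U μ n) (n - 1) ks)) *
          sectorSubMatrix L M β (bgmFatMultiplier L M klE0 β (nambuXiCT L μ (klFlowFrameU L M β U μ n)) m)) X Y‖ ≤ α) ∧
      (∀ Y, ∑ X, ‖((sectorSubMatrix L M β (bgmFatMultiplier L M klE0 β (nambuXiCT L μ (klFlowFrameU L M β U μ n)) m)).transpose *
          normalCovariance L M (fun ks => klE5SliceSym L M β μ (klFlowFrameU L M β U μ n) (n - 1) Λ ks /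
            (1 + klE5SliceSym L M β μ (klFlowFrameU L M β U μ n) (n - 1) Λ ks * klE5Kappa L M β U μ (klFlowFrameU L M β U μ n) (n - 1) ks)) *
          sectorSubMatrix L M β (bgmFatMultiplier L M klE0 β (nambuXiCT L μ (klFlowFrameU L M β U μ n)) m)) X Y‖ ≤ α) ∧
      α ≤ Cb * (imagTimeWeight β M)⁻¹ * (4 : ℝ) ^ n / klE0 := by
  obtain ⟨α, hα, hrows, hle⟩ := h Λ hΛ
  exact ⟨α, hα, hrows.1, hrows.2, hle⟩

end Law

/-! ## §3 The supplier's output by name: the (RA-U) and (RA-U)₀ rows -/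

section Output

variable (L M : ℕ) [NeZero L] [NeZero M]

/-- **`E5CarrierLawAt L M β U μ n Λ Qm x y g C₀ Θ`** — the (RA-U) row of `h3` in `exists_e5Pkg2_of_rows` BY NAME: at the step `n−1 → n`, cutoff `Λ`,
pair labels `(Qm; x, y)`, the (R1′) carrier `W_Λ = klE5Carrier … (K_n) (n−1) (klE5Kappa …) (klE5Input …) Λ` has, for every EVEN degree `m ≥ 4` and every
prescription `Ωe` at the point-augmented anisotropic family of level `n−2`, sectorised norm
`≤ C₀·Θ^{m/2}·g^{m/2−1}·2^{(3(m/2)−5)(n−2)}·(2^{−(n−2)})^{levelGainExp (levelCount Ωe)}` (coupling currency `g`; `g = P.Klam·U` under reading (A)). -/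
def E5CarrierLawAt (β U μ : ℝ) (n : ℕ) (Λ : ℝ) (Qm : TorusSite 2 L) (x y : TorusSite 2 L × MatsubaraIdx M) (g C₀ Θ : ℝ) : Prop :=
  ∀ m : ℕ, 4 ≤ m → Even m → ∀ Ωe : Fin m → Option (SectorLeg (sectorCount (n - 2) + 4)),
    hubbardSectorKernelNorm L M β (pointAugment (klAnisoFamily L M β μ (klFlowFrameU L M β U μ n) klE0 (n - 2)) (klE5ExtMomenta Qm x y))
        (prescribedTuples univ Ωe)
        (klE5Carrier L M β μ (klFlowFrameU L M β U μ n) (n - 1) (klE5Kappa L M β U μ (klFlowFrameU L M β U μ n) (n - 1))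
          (klE5Input L M β U μ (klFlowFrameU L M β U μ n) (n - 1)) Λ) ≤
      C₀ * Θ ^ (m / 2) * g ^ (m / 2 - 1) * (2 : ℝ) ^ ((3 * (m / 2) - 5) * (n - 2)) * (((2 : ℝ) ^ (n - 2))⁻¹) ^ levelGainExp (levelCount Ωe)

/-- **`E5CarrierLawTrivAt L M β U μ n Λ g C₀ Θ`** — the (RA-U)₀ row of `h12r` (first steps `n ≤ 2`, trivial one-sector family, flat law) BY NAME. -/
def E5CarrierLawTrivAt (β U μ : ℝ) (n : ℕ) (Λ : ℝ) (g C₀ Θ : ℝ) : Prop :=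
  ∀ m : ℕ, 4 ≤ m → Even m → ∀ Ωe : Fin m → Option (SectorLeg 1),
    hubbardSectorKernelNorm L M β (trivialMultiplier L M) (prescribedTuples univ Ωe)
        (klE5Carrier L M β μ (klFlowFrameU L M β U μ n) (n - 1) (klE5Kappa L M β U μ (klFlowFrameU L M β U μ n) (n - 1))
          (klE5Input L M β U μ (klFlowFrameU L M β U μ n) (n - 1)) Λ) ≤
      C₀ * Θ ^ (m / 2) * g ^ (m / 2 - 1)

variable {L M}

/-- `E5CarrierLawAt` at `g := P.Klam·U` IS the (RA-U) conjunct of `h3` in `exists_e5Pkg2_of_rows` (definitional restatement for the final `exact`). -/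
theorem e5CarrierLaw_h3_of {β U μ : ℝ} {n : ℕ} {Λ : ℝ} {Qm : TorusSite 2 L} {x y : TorusSite 2 L × MatsubaraIdx M} {Klam C₀ Θ : ℝ}
    (h : E5CarrierLawAt L M β U μ n Λ Qm x y (Klam * U) C₀ Θ) :
    ∀ m : ℕ, 4 ≤ m → Even m → ∀ Ωe : Fin m → Option (SectorLeg (sectorCount (n - 2) + 4)),
      hubbardSectorKernelNorm L M β (pointAugment (klAnisoFamily L M β μ (klFlowFrameU L M β U μ n) klE0 (n - 2)) (klE5ExtMomenta Qm x y))
          (prescribedTuples univ Ωe)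
          (klE5Carrier L M β μ (klFlowFrameU L M β U μ n) (n - 1) (klE5Kappa L M β U μ (klFlowFrameU L M β U μ n) (n - 1))
            (klE5Input L M β U μ (klFlowFrameU L M β U μ n) (n - 1)) Λ) ≤
        C₀ * Θ ^ (m / 2) * (Klam * U) ^ (m / 2 - 1) * (2 : ℝ) ^ ((3 * (m / 2) - 5) * (n - 2)) *
          (((2 : ℝ) ^ (n - 2))⁻¹) ^ levelGainExp (levelCount Ωe) :=
  h

/-- `E5CarrierLawTrivAt` at `g := P.Klam·U` IS the (RA-U)₀ conjunct of `h12r` in `exists_e5Pkg2_of_rows`. -/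
theorem e5CarrierLawTriv_h12r_of {β U μ : ℝ} {n : ℕ} {Λ : ℝ} {Klam C₀ Θ : ℝ} (h : E5CarrierLawTrivAt L M β U μ n Λ (Klam * U) C₀ Θ) :
    ∀ m : ℕ, 4 ≤ m → Even m → ∀ Ωe : Fin m → Option (SectorLeg 1),
      hubbardSectorKernelNorm L M β (trivialMultiplier L M) (prescribedTuples univ Ωe)
          (klE5Carrier L M β μ (klFlowFrameU L M β U μ n) (n - 1) (klE5Kappa L M β U μ (klFlowFrameU L M β U μ n) (n - 1))
            (klE5Input L M β U μ (klFlowFrameU L M β U μ n) (n - 1)) Λ) ≤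
        C₀ * Θ ^ (m / 2) * (Klam * U) ^ (m / 2 - 1) :=
  h

/-- Monotonicity of the (RA-U) row in `C₀` (`0 ≤ β`, `0 ≤ Θ`, `0 ≤ g`). -/
theorem E5CarrierLawAt.mono {β U μ : ℝ} (hβ : 0 ≤ β) {n : ℕ} {Λ : ℝ} {Qm : TorusSite 2 L} {x y : TorusSite 2 L × MatsubaraIdx M} {g C₀ C₀' Θ : ℝ}
    (hg : 0 ≤ g) (hΘ : 0 ≤ Θ) (h : E5CarrierLawAt L M β U μ n Λ Qm x y g C₀ Θ) (hC : C₀ ≤ C₀') : E5CarrierLawAt L M β U μ n Λ Qm x y g C₀' Θ := by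
  intro m hm he Ωe
  refine (h m hm he Ωe).trans ?_
  have _ := hβ
  have h1 : 0 ≤ Θ ^ (m / 2) * g ^ (m / 2 - 1) * (2 : ℝ) ^ ((3 * (m / 2) - 5) * (n - 2)) * (((2 : ℝ) ^ (n - 2))⁻¹) ^ levelGainExp (levelCount Ωe) := by
    positivity
  calc C₀ * Θ ^ (m / 2) * g ^ (m / 2 - 1) * (2 : ℝ) ^ ((3 * (m / 2) - 5) * (n - 2)) * (((2 : ℝ) ^ (n - 2))⁻¹) ^ levelGainExp (levelCount Ωe)
      = C₀ * (Θ ^ (m / 2) * g ^ (m / 2 - 1) * (2 : ℝ) ^ ((3 * (m / 2) - 5) * (n - 2)) * (((2 : ℝ) ^ (n - 2))⁻¹) ^ levelGainExp (levelCount Ωe)) := by ring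
    _ ≤ C₀' * (Θ ^ (m / 2) * g ^ (m / 2 - 1) * (2 : ℝ) ^ ((3 * (m / 2) - 5) * (n - 2)) * (((2 : ℝ) ^ (n - 2))⁻¹) ^ levelGainExp (levelCount Ωe)) :=
        mul_le_mul_of_nonneg_right hC h1
    _ = _ := by ring

end Output

end Summit.HubbardSuperconductivity.HubbardSuperconductivity.Theorems.KLRegimeSplit

end
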